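import Summits.Ventures.LatticeQCDFlow.Scaling.HubClassGlobalStartContentDeficit
import Summits.Ventures.LatticeQCDFlow.Scaling.TaggedCostSideDeep

/-!
HONEST FRAMING: exact (Metropolis-corrected) sampling algorithms for lattice gauge theory; figures
of merit are autocorrelation/cost numbers at stated couplings and volumes; no continuum-physics
claim.

# TaggedStartContentDeficitGlobal — THE SHARP START-CONTENT DEFICIT BOUND FOR W26'S TAGGED CHAINS OF AN ARBITRARY ADJACENT PAIR (PRESENT CONTENTS BETWEEN THE EXTRA PARTICLES
# ALLOWED), DEEP CONFIGURATION: `y_{n+1}(z) − x_{n+1}(z) ≤ 𝟙{n odd}γqⁿ`, `Σ_{n<J}(1−σ)σⁿ(y_{n+1}(z) − x_{n+1}(z))⁺ ≤ (1−σ)γσq/(1−σ²q²)`, `γ = P_X(z,z) − P_Y(z,z)`,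
# `q = max{0, N_C(z)/K − P_X(z,z)}` (lean-2 GEN-42, ours)

Venture-side (OURS).  Cell `lqcd-flow` (pub-lqcd), unit `pub-lqcd-lean-2-g42`, 2026-08-30.  Chapter AB (route (β), the cost side continued), file 5 = file 4 moved to the tagged hub
chains of W14∕W26 (chapter W's data on the content type `Option S`, Z4 `tagged_kernel_eq`, exactly as Z12 ∕ GEN-41 file 6) and integrated.  GEN-41 file 6 (A) needed «no present
content strictly between `W_b` and `W_a`»; HERE THAT PROVISO IS GONE.  Hypotheses: the tagged chains `P_X` (tag `a`), `P_Y` (tag `b`, `W_b ≤ W_a`) over a common ordinary composition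
`N_C` (`ΣN_C = K`, `K ≥ 2`), the `n`-attempt laws `x_n, y_n` from an ordinary hub `z` with `W_z ≤ W_b`, `W_z < W_a` and (`N_C(z) ≥ 2` or another present content AT OR above
`W_z` — the tie, which GEN-41 file 6 (A) excluded, is covered by file 4's tie-breaking enumeration).

* §1 `deficit_sharp_of_recursion` (real sequences): (P1) `e_{n+1} ≤ e_n·p − γβⁿ` (`p ≥ 0`) and (P2) `e_n ≤ (β−γ)ⁿ − βⁿ` (`γ ≥ 0`) ⇒ `e_{n+1} ≤ 𝟙{n odd}γ(max{0,−β})ⁿ`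
  ((P2) at odd steps, (P1) once at even steps — the mechanism of GEN-41 file 1).
* §2 **`tagged_startClass_recursion_global`**: (P1) ∧ (P2) for the tagged chains (`p = P_Y(z,z)`, `β = P_X(z,z) − N_C(z)/K`, `γ = P_X(z,z) − P_Y(z,z)`), from file 4;
  **`tagged_startClass_deficit_global`**: the sharp per-step bound and the discounted budget in the form of GEN-41 file 6 (A) (GEN-41 file 3 `budget_weighted_le`;
  `q ≤ acc(z,a)/K ≤ ½` by GEN-41 file 7 `costSide_q_le`).

File 6 feeds this budget to the cost side of GEN-41 file 7 ∕ file 1 of this chapter: Conjecture W′ on EVERY adjacent edge in the deep configuration.  TOY (`numerics42/global_sharp.py`,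
exact rationals, NOTHING CLAIMED beyond the typed theorems): 0 ∕ ≈ 12 000 violations of either form on global edges.  Literature grade (cell rule): OWN; nothing cited; no new bib keys.
-/

open Finset

namespace Summit.Ventures.LatticeQCDFlow.Scaling

/-! ### §1 From the chainable forms to the sharp per-step bound -/
section SharpOfRecursion

/-- **(P1) ∧ (P2) ⇒ the sharp per-step bound** `e_{n+1} ≤ 𝟙{n odd}·γ·(max{0,−β})ⁿ`. [ours] -/
theorem deficit_sharp_of_recursion {e : ℕ → ℝ} {p γ β : ℝ} (hp : 0 ≤ p) (hγ : 0 ≤ γ)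
    (h1 : ∀ n, e (n + 1) ≤ e n * p - γ * β ^ n) (h2 : ∀ n, e n ≤ (β - γ) ^ n - β ^ n) (n : ℕ) :
    e (n + 1) ≤ if Odd n then γ * (max 0 (-β)) ^ n else 0 := by
  -- odd steps: (P2) and the monotonicity of odd powers
  have hodd : ∀ k, Odd k → e k ≤ 0 := by
    intro k hk
    refine (h2 k).trans ?_
    have : (β - γ) ^ k ≤ β ^ k := (Odd.strictMono_pow hk).monotone (by linarith)
    linarith
  rcases Nat.even_or_odd n with hev | hod
  · rw [if_neg (Nat.not_odd_iff_even.mpr hev)]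
    exact hodd (n + 1) hev.add_one
  · rw [if_pos hod]
    -- even step `n + 1`: (P1) once, with `e_n ≤ 0`
    have hn : e n ≤ 0 := hodd n hod
    have hnp : e n * p ≤ 0 := mul_nonpos_of_nonpos_of_nonneg hn hp
    have hpow : -(γ * β ^ n) ≤ γ * (max 0 (-β)) ^ n := by
      have e1 : -(γ * β ^ n) = γ * (-β) ^ n := by rw [Odd.neg_pow hod]; ring
      rw [e1]
      refine mul_le_mul_of_nonneg_left ?_ hγ
      by_cases hb : 0 ≤ -β
      · rw [max_eq_right hb]
      · have : (-β) ^ n ≤ 0 := Odd.pow_nonpos hod (le_of_lt (not_le.mp hb))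
        exact this.trans (pow_nonneg (le_max_left _ _) n)
    linarith [h1 n]

end SharpOfRecursion

/-! ### §2 The tagged chains of an arbitrary adjacent pair -/
section TaggedGlobal
variable {S : Type*} [Fintype S] [DecidableEq S]
variable {W : S → ℝ} {acc : S → S → ℝ} {K : ℕ} {NC : S → ℕ} {a b : S} {PX PY : Option S → Option S → ℝ}

/-- **(P1) ∧ (P2) FOR THE TAGGED CHAINS OF AN ARBITRARY ADJACENT PAIR, deep configuration** (`0 ≤ P_Y(z,z)`, `0 ≤ γ` included). [ours] -/
theorem tagged_startClass_recursion_global (hW : ∀ v, 0 < W v) (hacc : ∀ h v, acc h v = min 1 (W h / W v)) (hK : 2 ≤ K) (hNC : ∑ v, NC v = K) (hab : W b ≤ W a)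
    (hPXoff : ∀ h v, h ≠ v → PX (some h) (some v) = if NC h = 0 then 0 else (NC v : ℝ) / K * acc h v)
    (hPXin : ∀ h, PX (some h) none = if NC h = 0 then 0 else acc h a / K)
    (hPXdiag : ∀ h, PX (some h) (some h) = 1 - (∑ v ∈ univ.erase h, PX (some h) (some v) + PX (some h) none))
    (hPXout : ∀ v, PX none (some v) = (NC v : ℝ) / K * acc a v) (hPXstay : PX none none = 1 - ∑ v, PX none (some v))
    (hPYoff : ∀ h v, h ≠ v → PY (some h) (some v) = if NC h = 0 then 0 else (NC v : ℝ) / K * acc h v)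
    (hPYin : ∀ h, PY (some h) none = if NC h = 0 then 0 else acc h b / K)
    (hPYdiag : ∀ h, PY (some h) (some h) = 1 - (∑ v ∈ univ.erase h, PY (some h) (some v) + PY (some h) none))
    (hPYout : ∀ v, PY none (some v) = (NC v : ℝ) / K * acc b v) (hPYstay : PY none none = 1 - ∑ v, PY none (some v))
    {z : S} (hz : NC z ≠ 0) (hzb : W z ≤ W b) (hza : W z < W a) (hthree : 2 ≤ NC z ∨ ∃ w, w ≠ z ∧ NC w ≠ 0 ∧ W z ≤ W w)
    {x y : ℕ → Option S → ℝ}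
    (hx0 : ∀ v, x 0 v = if v = some z then 1 else 0) (hxs : ∀ n v, x (n + 1) v = ∑ h, x n h * PX h v)
    (hy0 : ∀ v, y 0 v = if v = some z then 1 else 0) (hys : ∀ n v, y (n + 1) v = ∑ h, y n h * PY h v) :
    0 ≤ PY (some z) (some z) ∧ 0 ≤ PX (some z) (some z) - PY (some z) (some z)
      ∧ (∀ n, y (n + 1) (some z) - x (n + 1) (some z)
          ≤ (y n (some z) - x n (some z)) * PY (some z) (some z)
            - (PX (some z) (some z) - PY (some z) (some z)) * (PX (some z) (some z) - (NC z : ℝ) / K) ^ n)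
      ∧ (∀ n, y n (some z) - x n (some z) ≤ (PY (some z) (some z) - (NC z : ℝ) / K) ^ n - (PX (some z) (some z) - (NC z : ℝ) / K) ^ n) := by
  classical
  -- chapter W's data on the content type `Option S` (verbatim from Z12 ∕ GEN-41 file 6)
  obtain ⟨N', hN'⟩ : ∃ N' : Option S → ℕ, ∀ o, N' o = Option.elim o 1 NC := ⟨_, fun _ => rfl⟩
  obtain ⟨WX', hWX'⟩ : ∃ W' : Option S → ℝ, ∀ o, W' o = Option.elim o (W a) W := ⟨_, fun _ => rfl⟩
  obtain ⟨WY', hWY'⟩ : ∃ W' : Option S → ℝ, ∀ o, W' o = Option.elim o (W b) W := ⟨_, fun _ => rfl⟩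
  obtain ⟨accX', haccX'⟩ : ∃ acc' : Option S → Option S → ℝ, ∀ h v, acc' h v = min 1 (WX' h / WX' v) := ⟨_, fun _ _ => rfl⟩
  obtain ⟨accY', haccY'⟩ : ∃ acc' : Option S → Option S → ℝ, ∀ h v, acc' h v = min 1 (WY' h / WY' v) := ⟨_, fun _ _ => rfl⟩
  obtain ⟨offX, hoffX⟩ : ∃ off : (Option S → ℕ) → Option S → Option S → ℝ, ∀ M h v, off M h v = if M h = 0 then 0 else (M v : ℝ) / K * accX' h v :=
    ⟨_, fun _ _ _ => rfl⟩
  obtain ⟨offY, hoffY⟩ : ∃ off : (Option S → ℕ) → Option S → Option S → ℝ, ∀ M h v, off M h v = if M h = 0 then 0 else (M v : ℝ) / K * accY' h v :=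
    ⟨_, fun _ _ _ => rfl⟩
  obtain ⟨KhX, hKhX⟩ : ∃ Kh : (Option S → ℕ) → Option S → Option S → ℝ, ∀ M h v, Kh M h v = if h = v then 1 - ∑ v' ∈ univ.erase h, offX M h v' else offX M h v :=
    ⟨_, fun _ _ _ => rfl⟩
  obtain ⟨KhY, hKhY⟩ : ∃ Kh : (Option S → ℕ) → Option S → Option S → ℝ, ∀ M h v, Kh M h v = if h = v then 1 - ∑ v' ∈ univ.erase h, offY M h v' else offY M h v :=
    ⟨_, fun _ _ _ => rfl⟩
  have hKXoff : ∀ M h v, h ≠ v → KhX M h v = if M h = 0 then 0 else (M v : ℝ) / K * min 1 (WX' h / WX' v) := fun M h v hhv => by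
    rw [hKhX, if_neg hhv, hoffX, haccX']
  have hKYoff : ∀ M h v, h ≠ v → KhY M h v = if M h = 0 then 0 else (M v : ℝ) / K * min 1 (WY' h / WY' v) := fun M h v hhv => by
    rw [hKhY, if_neg hhv, hoffY, haccY']
  have hKXoff' : ∀ M h v, h ≠ v → KhX M h v = if M h = 0 then 0 else (M v : ℝ) / K * accX' h v := fun M h v hhv => by rw [hKXoff M h v hhv, haccX']
  have hKYoff' : ∀ M h v, h ≠ v → KhY M h v = if M h = 0 then 0 else (M v : ℝ) / K * accY' h v := fun M h v hhv => by rw [hKYoff M h v hhv, haccY']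
  have hKXdiag : ∀ M h, KhX M h h = 1 - ∑ v ∈ univ.erase h, KhX M h v := fun M h => by
    rw [hKhX, if_pos rfl]; congr 1; exact sum_congr rfl fun v hv => by rw [hKhX, if_neg (ne_of_mem_erase hv).symm]
  have hKYdiag : ∀ M h, KhY M h h = 1 - ∑ v ∈ univ.erase h, KhY M h v := fun M h => by
    rw [hKhY, if_pos rfl]; congr 1; exact sum_congr rfl fun v hv => by rw [hKhY, if_neg (ne_of_mem_erase hv).symm]
  have hPX : ∀ h v, PX h v = KhX N' h v := tagged_kernel_eq hacc hPXoff hPXin hPXdiag hPXout hPXstay hN' hWX' hKXoff hKXdiag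
  have hPY : ∀ h v, PY h v = KhY N' h v := tagged_kernel_eq hacc hPYoff hPYin hPYdiag hPYout hPYstay hN' hWY' hKYoff hKYdiag
  let KhnX : ℕ → Option S → Option S → ℝ := fun n =>
    Nat.rec (motive := fun _ => Option S → Option S → ℝ) (fun h v => if h = v then 1 else 0) (fun _ prev h v => ∑ w', prev h w' * KhX N' w' v) n
  let KhnY : ℕ → Option S → Option S → ℝ := fun n =>
    Nat.rec (motive := fun _ => Option S → Option S → ℝ) (fun h v => if h = v then 1 else 0) (fun _ prev h v => ∑ w', prev h w' * KhY N' w' v) n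
  have hKhnX0 : ∀ h v, KhnX 0 h v = if h = v then 1 else 0 := fun _ _ => rfl
  have hKhnXs : ∀ n h v, KhnX (n + 1) h v = ∑ w', KhnX n h w' * KhX N' w' v := fun _ _ _ => rfl
  have hKhnY0 : ∀ h v, KhnY 0 h v = if h = v then 1 else 0 := fun _ _ => rfl
  have hKhnYs : ∀ n h v, KhnY (n + 1) h v = ∑ w', KhnY n h w' * KhY N' w' v := fun _ _ _ => rfl
  have hxrow : ∀ n v, x n v = KhnX n (some z) v := by
    intro n; induction n with
    | zero => intro v; rw [hx0, hKhnX0]; by_cases h : v = some z <;> simp [h, eq_comm]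
    | succ n ih => intro v; rw [hxs, hKhnXs]; exact sum_congr rfl fun h _ => by rw [ih, hPX]
  have hyrow : ∀ n v, y n v = KhnY n (some z) v := by
    intro n; induction n with
    | zero => intro v; rw [hy0, hKhnY0]; by_cases h : v = some z <;> simp [h, eq_comm]
    | succ n ih => intro v; rw [hys, hKhnYs]; exact sum_congr rfl fun h _ => by rw [ih, hPY]
  -- the hypotheses of file 4 (no betweenness proviso)
  have hWXpos : ∀ o, 0 < WX' o := fun o => by rw [hWX']; rcases o with _ | v <;> simp [hW]
  have hWYpos : ∀ o, 0 < WY' o := fun o => by rw [hWY']; rcases o with _ | v <;> simp [hW]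
  have hagree : ∀ o, o ≠ none → WX' o = WY' o := fun o ho => by
    rcases o with _ | v
    · exact absurd rfl ho
    · rw [hWX', hWY']; rfl
  have hWt : WY' none ≤ WX' none := by rw [hWX', hWY']; exact hab
  have hNK : ∑ o, (N' o : ℝ) = K + 1 := by
    have h1 : ∑ o, (N' o : ℝ) = 1 + ∑ v, (NC v : ℝ) := by rw [Fintype.sum_option]; simp [hN', Option.elim]
    have h2 : ∑ v, (NC v : ℝ) = K := by exact_mod_cast hNC
    rw [h1, h2]; ring
  have hNt : N' none = 1 := by rw [hN']; simp
  have hzN : N' (some z) ≠ 0 := by rw [hN']; exact hz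
  have hzt : (some z : Option S) ≠ none := Option.some_ne_none z
  have hzb' : WX' (some z) ≤ WY' none := by rw [hWX', hWY']; exact hzb
  have hza' : WX' (some z) < WX' none := by rw [hWX', hWX']; exact hza
  have hthree' : 2 ≤ N' (some z) ∨ ∃ o, o ≠ some z ∧ o ≠ none ∧ N' o ≠ 0 ∧ WX' (some z) ≤ WX' o := by
    rcases hthree with h2 | ⟨w, hwz, hw, hzw⟩
    · left; rw [hN']; exact h2
    · right
      refine ⟨some w, fun h => hwz (Option.some_inj.mp h), Option.some_ne_none w, by rw [hN']; exact hw, ?_⟩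
      rw [hWX', hWX']; exact hzw
  obtain ⟨h0, hγ, h1, h2⟩ := hubClass_global_startClass_recursion hK hNK hNt hWXpos hWYpos hagree hWt haccX' haccY' hKXoff' hKXdiag hKYoff' hKYdiag
    hKhnX0 hKhnXs hKhnY0 hKhnYs hzN hzt hzb' hza' hthree'
  have hNz' : (N' (some z) : ℝ) = NC z := by rw [hN']; rfl
  rw [hNz'] at h1 h2
  refine ⟨by rw [hPY]; exact h0, by rw [hPX, hPY]; exact hγ, fun n => ?_, fun n => ?_⟩
  · have h := h1 n
    rw [hxrow, hyrow, hxrow, hyrow, hPX, hPY]; exact h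
  · have h := h2 n
    rw [hxrow, hyrow, hPX, hPY]; exact h

/-- **THE SHARP START-CONTENT DEFICIT BOUND AND ITS DISCOUNTED BUDGET FOR AN ARBITRARY ADJACENT PAIR, deep configuration** (the form of GEN-41 file 6 (A), without the
depth-adjacency proviso). [ours] -/
theorem tagged_startClass_deficit_global (hW : ∀ v, 0 < W v) (hacc : ∀ h v, acc h v = min 1 (W h / W v)) (hK : 2 ≤ K) (hNC : ∑ v, NC v = K) (hab : W b ≤ W a)
    (hPXoff : ∀ h v, h ≠ v → PX (some h) (some v) = if NC h = 0 then 0 else (NC v : ℝ) / K * acc h v)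
    (hPXin : ∀ h, PX (some h) none = if NC h = 0 then 0 else acc h a / K)
    (hPXdiag : ∀ h, PX (some h) (some h) = 1 - (∑ v ∈ univ.erase h, PX (some h) (some v) + PX (some h) none))
    (hPXout : ∀ v, PX none (some v) = (NC v : ℝ) / K * acc a v) (hPXstay : PX none none = 1 - ∑ v, PX none (some v))
    (hPYoff : ∀ h v, h ≠ v → PY (some h) (some v) = if NC h = 0 then 0 else (NC v : ℝ) / K * acc h v)
    (hPYin : ∀ h, PY (some h) none = if NC h = 0 then 0 else acc h b / K)
    (hPYdiag : ∀ h, PY (some h) (some h) = 1 - (∑ v ∈ univ.erase h, PY (some h) (some v) + PY (some h) none))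
    (hPYout : ∀ v, PY none (some v) = (NC v : ℝ) / K * acc b v) (hPYstay : PY none none = 1 - ∑ v, PY none (some v))
    {z : S} (hz : NC z ≠ 0) (hzb : W z ≤ W b) (hza : W z < W a) (hthree : 2 ≤ NC z ∨ ∃ w, w ≠ z ∧ NC w ≠ 0 ∧ W z ≤ W w)
    {x y : ℕ → Option S → ℝ}
    (hx0 : ∀ v, x 0 v = if v = some z then 1 else 0) (hxs : ∀ n v, x (n + 1) v = ∑ h, x n h * PX h v)
    (hy0 : ∀ v, y 0 v = if v = some z then 1 else 0) (hys : ∀ n v, y (n + 1) v = ∑ h, y n h * PY h v) :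
    (∀ n, y (n + 1) (some z) - x (n + 1) (some z)
        ≤ (if Odd n then (PX (some z) (some z) - PY (some z) (some z)) * (max 0 ((NC z : ℝ) / K - PX (some z) (some z))) ^ n else 0))
    ∧ (∀ σ : ℝ, 0 ≤ σ → σ ≤ 1 → ∀ J, ∑ n ∈ range J, (1 - σ) * σ ^ n * max 0 (y (n + 1) (some z) - x (n + 1) (some z))
        ≤ (1 - σ) * ((PX (some z) (some z) - PY (some z) (some z))
            * (σ * max 0 ((NC z : ℝ) / K - PX (some z) (some z)) / (1 - (σ * max 0 ((NC z : ℝ) / K - PX (some z) (some z))) ^ 2)))) := by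
  have hK1 : 1 ≤ K := by omega
  have hK0 : (0 : ℝ) < K := by exact_mod_cast (show 0 < K by omega)
  obtain ⟨h0, hγ, h1, h2⟩ := tagged_startClass_recursion_global hW hacc hK hNC hab hPXoff hPXin hPXdiag hPXout hPXstay hPYoff hPYin hPYdiag hPYout hPYstay
    hz hzb hza hthree hx0 hxs hy0 hys
  set γ := PX (some z) (some z) - PY (some z) (some z) with hγdef
  set β := PX (some z) (some z) - (NC z : ℝ) / K with hβdef
  have hβY : PY (some z) (some z) - (NC z : ℝ) / K = β - γ := by rw [hβdef, hγdef]; ring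
  rw [hβY] at h2
  have hq : max 0 ((NC z : ℝ) / K - PX (some z) (some z)) = max 0 (-β) := by rw [hβdef, neg_sub]
  have hsharp : ∀ n, y (n + 1) (some z) - x (n + 1) (some z) ≤ if Odd n then γ * (max 0 (-β)) ^ n else 0 := fun n =>
    deficit_sharp_of_recursion (e := fun n => y n (some z) - x n (some z)) h0 hγ h1 h2 n
  rw [hq]
  refine ⟨hsharp, fun σ hσ0 hσ1 J => ?_⟩
  -- the discounted budget: `q ≤ acc(z,a)/K ≤ 1/2`, GEN-41 file 3 `budget_weighted_le`
  set q := max 0 (-β) with hqdef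
  have hq0 : 0 ≤ q := le_max_left _ _
  have hα1 : acc z a ≤ 1 := by rw [hacc]; exact min_le_left _ _
  have hqle : q ≤ acc z a / K := by
    refine max_le (div_nonneg (starHub_acc_nonneg hW hacc z a) hK0.le) ?_
    have := costSide_q_le hacc hK1 hNC hPXoff hPXin hPXdiag hz (a := a)
    rw [hβdef]; linarith
  have hK2 : (2 : ℝ) ≤ K := by exact_mod_cast hK
  have hq2 : q ≤ 1 / 2 := by
    calc q ≤ acc z a / K := hqle
      _ ≤ 1 / K := div_le_div_of_nonneg_right hα1 hK0.le
      _ ≤ 1 / 2 := one_div_le_one_div_of_le (by norm_num) hK2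
  have hσq : σ * q < 1 := by nlinarith
  have hterm : ∀ n, max 0 (y (n + 1) (some z) - x (n + 1) (some z)) ≤ (if Odd n then γ * q ^ n else 0) := by
    intro n
    refine max_le ?_ (hsharp n)
    split_ifs
    · exact mul_nonneg hγ (pow_nonneg hq0 n)
    · exact le_rfl
  calc ∑ n ∈ range J, (1 - σ) * σ ^ n * max 0 (y (n + 1) (some z) - x (n + 1) (some z))
      ≤ ∑ n ∈ range J, (1 - σ) * (σ ^ n * (if Odd n then γ * q ^ n else 0)) := by
        refine sum_le_sum fun n _ => ?_
        rw [mul_assoc]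
        exact mul_le_mul_of_nonneg_left (mul_le_mul_of_nonneg_left (hterm n) (pow_nonneg hσ0 n)) (by linarith)
    _ = (1 - σ) * ∑ n ∈ range J, σ ^ n * (if Odd n then γ * q ^ n else 0) := by rw [mul_sum]
    _ ≤ (1 - σ) * (γ * (σ * q / (1 - (σ * q) ^ 2))) := mul_le_mul_of_nonneg_left (budget_weighted_le hσ0 hq0 hσq hγ J) (by linarith)

end TaggedGlobal

end Summit.Ventures.LatticeQCDFlow.Scaling
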